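import Summits.ResolutionOfSingularities.ResolutionOfSingularities.Theorems.MarkedTransferCampaignW46MohWindowShadeFormalNRChart
import HarnessLib

/-!
# [OURS · L1 W4.6 rung (iii-2), NON-RATIONAL W-WALK over an ARBITRARY ground field, brick 11] Hensel and formal-chart recognition at a
# non-rational point whose minimal polynomial is SEPARABLE (the `[PerfectField K]` of gen 7's brick 1 replaced by a separability INPUT)

Cell `res-hironaka`, LADDER-RESOLUTION rung L (D-0089), slot W4.6 rung (iii); seat res-L1-s46-pv-6 (gen 8). Host route MarkedTransfer,
`--supports stmt-ResolutionOfSingularities-16155 --as helper`; kind proof (def-free). The imperfect-`K` road (res-L1-s46-pv-5's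
`W-WALK-PLAN.md` §7.2 (c)): gen 7's `…MohWindowShadeFormalNRChart.exists_root_of_irreducible` / `exists_ringEquiv_chart_nr` assumed the
coefficient field PERFECT only to know that the irreducible minimal polynomial `π` of the point is separable (Hensel needs `π′(a₀)` a unit).
Here the SAME two statements are proved with `(hsep : π.Separable)` as a hypothesis and NO perfectness: `exists_root_of_separable`,
`exists_ringEquiv_chart_nr_of_separable` (proofs verbatim otherwise). Along a thread inside o1's regime `regimeMohWindowSurfaceInsep` the
residue-field extensions of consecutive points ARE separable over any ground field (res-L1-s46-pv-5's `WWalk.false_of_inseparable_child`,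
p577683), which is what feeds `hsep` downstream (`…WWalkNRStepCoreSep`, `…WWalkNRStepSep`).

HONEST FRAMING. OURS; NOT a statement of H. Hironaka's manuscript [Hironaka2017]; nothing of it is used. AI-written; AI review is weaker
than expert review. No `sorry`; axioms standard. References: H. Matsumura, *Commutative Ring Theory* (1986), Thm. 8.3 (Hensel), Thm. 28.3
(coefficient fields), Thm. 29.7 [Matsumura1987]. [folklore]
-/

noncomputable section

set_option linter.dupNamespace false -- mandated namespace of this single-conjunct summit

open IsLocalRing MvPowerSeries

namespace Summit.ResolutionOfSingularities.ResolutionOfSingularities.Theorems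

namespace CampaignW46

namespace WWalkNR

open CampaignW46.FormalChart (exists_ringEquiv_mvPowerSeries_of_generators exists_algEquiv_shear)
open CampaignW46.MohWindowShadeFormalNR (eval_sub_eval_mem exists_coeffField)

/-! ## §1 Hensel for a separable polynomial -/

section Hensel

variable {K : Type} [Field K] {T : Type} [CommRing T] [IsLocalRing T] (ι : K →+* T)

/-- **HENSEL for the separable minimal polynomial of the point.** `π ∈ K[X]` SEPARABLE and monic over ANY field (gen 8, imperfect-`K` road: the separability is an INPUT), `ι : K → T`
into a complete local ring, `a₀ ∈ T` with `π^ι(a₀) ∈ 𝔪_T` ⟹ the derivative `(π′)^ι(a₀)` is a unit (Bézout: `π` is separable) and there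
is a root `a ≡ a₀ (mod 𝔪_T)` of `π^ι`. [cite: Matsumura1987, Thm. 8.3] [folklore] -/
theorem exists_root_of_separable [IsAdicComplete (maximalIdeal T) T] {π : Polynomial K} (hsep : π.Separable)
    (hm : π.Monic) (a₀ : T) (ha₀ : (π.map ι).eval a₀ ∈ maximalIdeal T) :
    IsUnit (((Polynomial.derivative π).map ι).eval a₀) ∧ ∃ a : T, (π.map ι).IsRoot a ∧ a - a₀ ∈ maximalIdeal T := by
  obtain ⟨u, v, huv⟩ := hsep
  have hunit : IsUnit (((Polynomial.derivative π).map ι).eval a₀) := by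
    have h1 : (u.map ι).eval a₀ * (π.map ι).eval a₀ + (v.map ι).eval a₀ * ((Polynomial.derivative π).map ι).eval a₀ = 1 := by
      have := congrArg (fun q : Polynomial K => (q.map ι).eval a₀) huv
      simpa only [Polynomial.map_add, Polynomial.map_mul, Polynomial.map_one, Polynomial.eval_add, Polynomial.eval_mul,
        Polynomial.eval_one] using this
    have h2 : IsUnit ((v.map ι).eval a₀ * ((Polynomial.derivative π).map ι).eval a₀) := by
      have h3 : (v.map ι).eval a₀ * ((Polynomial.derivative π).map ι).eval a₀ = 1 - (u.map ι).eval a₀ * (π.map ι).eval a₀ := by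
        rw [← h1]; ring
      rw [h3]
      exact IsLocalRing.isUnit_one_sub_self_of_mem_nonunits _ (Ideal.mul_mem_left _ _ ha₀)
    exact isUnit_of_mul_isUnit_right h2
  refine ⟨hunit, ?_⟩
  have hH := (IsAdicComplete.henselianRing T (maximalIdeal T)).is_henselian (π.map ι) (hm.map ι) a₀ ha₀ ?_
  · exact hH
  · rw [Polynomial.derivative_map]
    exact hunit.map _
end Hensel

/-! ## §2 Formal-chart recognition at a non-rational point with separable minimal polynomial -/

section Recognition

variable {K : Type} [Field K] {T : Type} [CommRing T] [IsLocalRing T] [IsNoetherianRing T]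
  [IsAdicComplete (maximalIdeal T) T]

/-- [OURS · L1 W4.6 — DICTIONARY AT A NON-RATIONAL POINT, brick 1; replaces the role of «the blowup `π : Z′ → Z` with center `D`»
(H. Hironaka, ms. 2017, Th. 16.6 p.84 l.4–8) ON COMPLETED LOCAL RINGS AT A NON-RATIONAL CLOSED POINT of the exceptional plane; NOT a
statement of the manuscript] **Formal-chart recognition at a non-rational point.** Let `φ : K⟦z, u₀, u₁⟧ → T` be a ring map into a
complete Noetherian local ring of dimension `3` (`z = X none`, `u_l = X (some l)`; in the application `φ = π̂^♯ ∘ E₀⁻¹`), `i₀ ≠ i₁` the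
two `u`-indices, `e_j ∈ T` with `φ(X_j) = φ(X_{u_{i₀}}) · e_j` (the point lies in the chart `u_{i₀}`), `π ∈ K[X]` irreducible monic
AND SEPARABLE (the minimal polynomial over `K` of the `u_{i₁}/u_{i₀}`-coordinate of the point; `K` ARBITRARY — gen 8, imperfect-`K` road: separability is an input, supplied along a thread inside the regime by res-L1-s46-pv-5's `WWalk.false_of_inseparable_child`) with
`𝔪_T = (φ X_{u_{i₀}}, e_z, π^{φC}(e_{u_{i₁}}))` (`e_z ∈ 𝔪_T`: the point lies on the line `z = 0` of the exceptional plane), and suppose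
every element of `T` is a `K`-polynomial in `e_{u_{i₁}}` modulo `𝔪_T` (the residue field of `T` is `K(λ)`). Then for every cleaning
shear `s ∈ K′⟦z, u⟧` (`z`-free, `s(0) = 0`), `K′ = K(λ) = AdjoinRoot π`: `T ≅ K′⟦z, u₀, u₁⟧` by an `E` with `E ∘ φ ∘ C = C ∘ (K → K′)`,
`E(φ X_{u_{i₀}}) = X_{u_{i₀}}`, `E(φ X_{u_{i₁}}) = X_{u_{i₀}} (X_{u_{i₁}} + C λ)`, `E(φ X_z) = X_{u_{i₀}} (X_z + s)`.
[cite: Matsumura1987, Thm. 29.7] [cite: Matsumura1987, Thm. 28.3] [folklore] -/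
theorem exists_ringEquiv_chart_nr_of_separable (φ : MvPowerSeries (Option (Fin 2)) K →+* T) {i₀ i₁ : Fin 2} (hi : i₁ ≠ i₀)
    (htwo : ∀ l : Fin 2, l = i₀ ∨ l = i₁) (e : Option (Fin 2) → T) (he : ∀ j, j ≠ some i₀ → φ (X j) = φ (X (some i₀)) * e j)
    (π : Polynomial K) [Fact (Irreducible π)] (hm : π.Monic) (hsep : π.Separable)
    (hgen : Ideal.span {φ (X (some i₀)), e none, (π.map (φ.comp MvPowerSeries.C)).eval (e (some i₁))} = maximalIdeal T)
    (hres : ∀ c : T, ∃ P : Polynomial K, c - (P.map (φ.comp MvPowerSeries.C)).eval (e (some i₁)) ∈ maximalIdeal T)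
    (hdim : ringKrullDim T = 3) (s : MvPowerSeries (Option (Fin 2)) (AdjoinRoot π)) (hs0 : constantCoeff s = 0)
    (hs : subst (fun j : Option (Fin 2) => if j = none then (0 : MvPowerSeries (Option (Fin 2)) (AdjoinRoot π)) else X j) s = s) :
    ∃ E : T ≃+* MvPowerSeries (Option (Fin 2)) (AdjoinRoot π),
      (∀ l, E (φ (MvPowerSeries.C l)) = MvPowerSeries.C (AdjoinRoot.of π l)) ∧
      E (φ (X (some i₀))) = X (some i₀) ∧
      E (φ (X (some i₁))) = X (some i₀) * (X (some i₁) + MvPowerSeries.C (AdjoinRoot.root π)) ∧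
      E (φ (X none)) = X (some i₀) * (X none + s) := by
  classical
  set ι : K →+* T := φ.comp MvPowerSeries.C with hι
  -- the minimal polynomial vanishes at the point modulo `𝔪`
  have hπe : (π.map ι).eval (e (some i₁)) ∈ maximalIdeal T := by
    rw [← hgen]; exact Ideal.subset_span (by simp)
  -- Hensel lift of the coordinate and the grown coefficient field
  obtain ⟨-, a, ha, haa₀⟩ := exists_root_of_separable ι hsep hm (e (some i₁)) hπe
  obtain ⟨ι', hι'of, hι'root, hι'mk, hι'res⟩ := exists_coeffField ι π a (e (some i₁)) ha haa₀ hres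
  -- recentred generators of `𝔪_T`
  set x : Option (Fin 2) → T := fun j => if j = some i₀ then φ (X (some i₀)) else if j = none then e none else e (some i₁) - a with hx
  have hxi₀ : x (some i₀) = φ (X (some i₀)) := by rw [hx]; exact if_pos rfl
  have hxz : x none = e none := by
    rw [hx]; dsimp only; rw [if_neg (Option.some_ne_none i₀).symm, if_pos rfl]
  have hxi₁ : x (some i₁) = e (some i₁) - a := by
    rw [hx]; dsimp only; rw [if_neg (fun h => hi (Option.some_injective _ h)), if_neg (Option.some_ne_none i₁)]
  have hgen' : Ideal.span (Set.range x) = maximalIdeal T := by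
    apply le_antisymm
    · rw [Ideal.span_le]
      rintro _ ⟨j, rfl⟩
      rw [SetLike.mem_coe]
      cases j with
      | none => rw [hxz, ← hgen]; exact Ideal.subset_span (by simp)
      | some l =>
        rcases htwo l with rfl | rfl
        · rw [hxi₀, ← hgen]; exact Ideal.subset_span (by simp)
        · rw [hxi₁, ← Ideal.neg_mem_iff, neg_sub]; exact haa₀
    · rw [← hgen, Ideal.span_le]
      have hxmem : ∀ j, x j ∈ Ideal.span (Set.range x) := fun j => Ideal.subset_span ⟨j, rfl⟩
      rintro t ht
      simp only [Set.mem_insert_iff, Set.mem_singleton_iff] at ht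
      rw [SetLike.mem_coe]
      rcases ht with rfl | rfl | rfl
      · rw [← hxi₀]; exact hxmem _
      · rw [← hxz]; exact hxmem _
      · -- `π^ι(e) = (e − a) · q(e)`
        have hfac := (Polynomial.mul_divByMonic_eq_iff_isRoot (p := π.map ι) (a := a)).mpr ha
        have h1 : (π.map ι).eval (e (some i₁)) = (e (some i₁) - a) * ((π.map ι) /ₘ (Polynomial.X - Polynomial.C a)).eval (e (some i₁)) := by
          conv_lhs => rw [← hfac]
          rw [Polynomial.eval_mul, Polynomial.eval_sub, Polynomial.eval_X, Polynomial.eval_C]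
        rw [h1, ← hxi₁]
        exact Ideal.mul_mem_right _ _ (hxmem _)
  have hdim' : ringKrullDim T = Fintype.card (Option (Fin 2)) := by rw [hdim]; simp
  obtain ⟨E₁, hE₁x, hE₁C⟩ := exists_ringEquiv_mvPowerSeries_of_generators ι' hι'res x hgen' hdim'
  obtain ⟨θ, hθz, hθj⟩ := exists_algEquiv_shear none s hs0 hs
  have hθC : ∀ l, θ (MvPowerSeries.C l) = MvPowerSeries.C l := fun l => by
    rw [MvPowerSeries.c_eq_algebraMap]; exact θ.commutes l
  refine ⟨E₁.trans θ.toRingEquiv, fun l => ?_, ?_, ?_, ?_⟩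
  · change θ (E₁ (φ (MvPowerSeries.C l))) = _
    have : φ (MvPowerSeries.C l) = ι' (AdjoinRoot.of π l) := by rw [hι'of]; rfl
    rw [this, hE₁C, hθC]
  · change θ (E₁ (φ (X (some i₀)))) = _
    rw [← hxi₀, hE₁x, hθj _ (Option.some_ne_none i₀)]
  · change θ (E₁ (φ (X (some i₁)))) = _
    have h1 : e (some i₁) = x (some i₁) + ι' (AdjoinRoot.root π) := by rw [hxi₁, hι'root]; ring
    rw [he _ (fun h => hi (Option.some_injective _ h)), map_mul, map_mul, ← hxi₀, hE₁x, h1, map_add, hE₁x, hE₁C, map_add,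
      hθj _ (Option.some_ne_none i₀), hθj _ (Option.some_ne_none i₁), hθC]
  · change θ (E₁ (φ (X none))) = _
    rw [he _ (Option.some_ne_none i₀).symm, map_mul, map_mul, ← hxi₀, hE₁x, ← hxz, hE₁x, hθj _ (Option.some_ne_none i₀), hθz]

end Recognition

end WWalkNR

end CampaignW46

end Summit.ResolutionOfSingularities.ResolutionOfSingularities.Theorems

end
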